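import Summits.AtomisticToContinuum.FouriersLaw.Theses.EmbeddedDrudeMourre
import Summits.AtomisticToContinuum.FouriersLaw.Theorems.FGRGap.Negative.LoadBearing
import Summits.AtomisticToContinuum.FouriersLaw.Theorems.FGRGap.Negative.OnsiteReduction

/-!
# Line `chord-quartic-abel` for crux `FGRGap` (item stmt-AtomisticToContinuum-12595)

Crux (route EmbeddedDrudeMourre, rank 3; FIXED, never restated):
`FGRGap := ∀ ω₂ a b, 0 < ω₂ → 0 < a → 0 < b → PhononBoltzmann.HasOddSectorGap ω₂ a b`
(odd-sector gap of ALS's linearised 2↔2 phonon-Boltzmann Dirichlet form `q` of the pinned band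
`ω(k)² = ω₂ + 2(1 - cos k)`, vertex `Φ = a + 16b ∏ sin(k_j/2)`).

Idea card `Cruxes/FGRGap/Ideas/chord-quartic-abel.md` (crux-ideate r1 ideator 2; triage r1: pass ×3).
LEVER: the phonon point `P(k) = (ω(k), sin k)` lies on the tacnodal plane quartic
`C₄ : (X² - ω₂ - 2)² + 4Y² = 4` (canonical model of the phonon elliptic curve; `phononPoint_mem_quartic`
below), and a NON-TRIVIAL 2↔2 resonance `(k₁,k₂) → (k₃,k₄)` holds iff `P(k₁), P(k₂), -P(k₃), -P(k₄)` are
COLLINEAR (energy = vanishing `X³`-coefficient of a line section, momentum = Abel's theorem for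
`dk = dz/iz`). Hence the resonance 4-web (the four foliations `{k_i = const}` of the 2-dimensional
resonant surface) is the chord web of `C₄`; by Abel's theorem for its three regular differentials
`⟨dk, dω, du := dk/ω⟩` and Bol's rank bound `π(2,4) = 3` its abelian relations on any piece in general
position are EXACTLY `span{(k,k,-k,-k), (ω,ω,-ω,-ω), (u,u,u,u)} ⊕ constants`; the elliptic logarithm
`u = ∫₀ᵏ dk'/ω` enters with the bosonic sign pattern `(+,+,+,+)` (an ANTI-invariant), so chartwise every
smooth collisional invariant is `αk + βω ± γu + c`; overlapping slot projections of near-grazing charts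
force `γ = 0`, `2π`-periodicity (one umklapp) forces `α = 0`: smooth invariants are `c + dω`, hence no odd
one — half (a) of the crux for EVERY `ω₂ > 0`, even sector included. Half (b) (coercivity given no odd null
vector) is the shared Weyl stub (Lukkarinen's truncated `V' - K'` + compactness), where `0 < a` enters.

SKELETON (6 registered stubs + the kernel-checked composition `FGRGap_of`; general position of a
resonance := `0 < velocityGap` = the four group velocities pairwise distinct = pairwise transversality
of the four foliations, computed: `dk₂ ∥ dk₁ ⇔ v₃ = v₄`, `dk₂ ∥ dk₃ ⇔ v₁ = v₄`, `dk₄ ∥ dk₁ ⇔ v₂ = v₃`,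
`dk₄ ∥ dk₃ ⇔ v₁ = v₂`, `dk₂ ∥ dk₄ ⇔ v₁ = v₃`, chart `∂₂Ω ≠ 0 ⇔ v₂ ≠ v₄`):
* `stub_resonanceIsChord`       — S1, algebra (M): non-trivial resonance ⇒ `det3 (P₁) (P₂) (-P₃) = 0`.
  Gen 2: CLOSED-FORM route — on any resonance `E·det3 = sin δ·L(cos φ)` and `0 = Q(cos φ) = (cos φ - cos δ)·L(cos φ)`
  in the half-sum variables `K = k₁+k₂`, `δ = (k₁-k₂)/2`, `φ = k₃ - K/2` (docstring of S1); no uniqueness,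
  convexity or `Polynomial` machinery; by-product: the non-trivial branch in closed form (`cos φ = γ`).
* `stub_antiInvariant_of_chord` — S2, calculus (M): S1 ⇒ on every general-position chart `(U, h)` of the
  resonant surface `u(k₁) + u(k₂) + u(k₃) + u(k₄)` is CONSTANT (chain rule; `∂₁h, ∂₃h` are ratios of
  velocity differences; zero gradient ⇔ collinearity of the projective images `(v_i, ±1/ω_i)` of the
  four phonon points under `(X,Y) ↦ (Y/X, 1/X)`).
* `stub_abelBolSpan`            — S3, rank bound (L, elementary): on a general-position chart carrying the
  anti-invariant, every SMOOTH abelian relation `g₁(k₁)+g₂(k₂)+g₃(k₃)+g₄(k₄) ≡ 0` lies in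
  `span{R_k, R_ω, R_u} ⊕ constants` (Bol's bound rank ≤ 3 + independence of `1, k, ω, u` on intervals).
  Gen 2: ELEMENTARY route — `∂₁∂₃` of the relation kills the coordinate slots, the remaining identity (E1) closes
  at the next order into a rank-3 linear total differential system for `(g₂'∘h, g₄'∘k₄, g₄''∘k₄)` because
  `dk₂ ∧ dk₄ ≠ 0`; Grönwall along paths ⇒ rank ≤ 3 in the SMOOTH category (docstring of S3); Abel explains,
  no web-geometry import needed.
* `stub_gluing`                 — S4, propagation (M/L): the chartwise span property ⇒ every smooth
  `2π`-periodic `ψ` satisfying the invariant identity at all general-position resonances is `c + dω`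
  (near-grazing charts by the IFT at `k₂ = k*`, `v'(k*) ≠ 0`; slot-1/slot-3 projections overlap ⇒ `γ = 0`;
  projections cover `𝕋` up to finitely many points ⇒ one `(α, β)`; periodicity ⇒ `α = 0`). This is where
  `hasOddSectorGap_false_without_periodic` (witness `k ↦ k` = `R_k`!) is honoured.
* `stub_bootstrap`              — S5, regularity (L): `0 < ω₂`, `0 < a`, `0 ≤ b`: an `L²` periodic null
  vector of `q` is a.e. a smooth periodic function invariant at all general-position resonances
  (LS08 §5 averaging; the submersion conditions of the averaging maps ARE the velocity inequalities).
* `stub_weylReduction`          — S6, coercivity (L/XL): `0 < ω₂`, `0 < a`, `0 ≤ b`: no odd periodic `L²`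
  null vector of `q` ⇒ `HasOddSectorGap` (minimising sequence, `q ≥ q_ε = V_ε - K_ε` with all kernels
  bounded on `{velocityGap ≥ ε}`, `V_ε ≥ v₀(ε,a) > 0` — uses `0 < a`: at `a = 0` the fibre `k = 0` is
  dead, the disprover's near-miss `not_hasOddSectorGap_zero_onsite` —, `K_ε` Hilbert–Schmidt, weak limit
  non-zero, `q = sup_ε q_ε` by monotone convergence). Verbatim the shape `GapOfNoOddNullVector` agreed by
  the triage panel; shareable with the jet lines.
* `FGRGap_of` — sorry-free: S6 ∘ [S5, S4 ∘ (S3 ∘ S2 ∘ S1), oddness glue (`f` odd, `f =ᵐ ψ`, `ψ`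
  continuous ⇒ `ψ` odd; `ψ = c + dω` even ⇒ `ψ ≡ 0` ⇒ `‖f‖² = 0`)].

Disproof.lean (cdisprove gen 2 c1) honoured: `_false_without_periodic` at S4 (α = 0) and S5/S6
(periodic hypotheses); `_false_without_odd` in `FGRGap_of` (the classification DOES produce the even null
vectors `1, ω`; oddness kills them); `crux_false_without_omegaPos` — `0 < ω₂` is a hypothesis of every stub
(`c = ω₂ + 2 > 2`: two smooth real ovals; `u' = 1/ω`; analytic band for the IFT charts; `ω ≥ √ω₂` in the
kernel bounds); `crux_false_without_couplings` / near-miss `not_hasOddSectorGap_zero_onsite` — `0 < a` is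
used at S6 only, `0 < b` nowhere (`0 ≤ b`), matching `onsite_of_crux`; `no_uniform_gap` — the gap constant
lives inside `HasOddSectorGap ω₂ a b`, nothing uniform is claimed. No stub is an instance refuted by the
landed `Theorems/FGRGap/Negative/{LoadBearing, OnsiteReduction}` (imported below; see the `example`s at the
end).

PROVENANCE. Gen 1 (planner-cruxplan-…-chord-quartic-abel-0, 2026-08-16T04:02Z, skeleton sha dce904d9…):
objects, the six stub STATEMENTS, `Registered.*`, `FGRGap_of`. Gen 2 (planner-cruxplan-…-chord-quartic-abel-g2-0,
this file): stub names and statements kept VERBATIM (triage-endorsed shapes; re-registered), `FGRGap_of`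
unchanged; NEW are the proof routes in the docstrings of S1 (closed form), S3 (second-order finite-type
closure), S4 (explicit near-diagonal expansions), S5 (closed-form branch `h`), each backed by the pure-python
checks `num/s1_poly.py`, `num/s1_closed.py`, `num/s1_route.py`, `num/s3_closure.py`, `num/explicit_branch.py`
of the gen-2 planner folder (attached as evidence on the crux item).
-/

noncomputable section

open MeasureTheory Set Real Filter Topology
open scoped ENNReal
open Literature.MathematicalPhysics.KineticTheory.PhononBoltzmann

namespace Summit.AtomisticToContinuum.FouriersLaw.Cruxes.FGRGap.ChordQuarticAbel

/-! ## Objects of the line (definitions only; no axioms) -/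

/-- The phonon point `P(k) = (ω(k), sin k)`; it lies on the tacnodal quartic
`(X² - ω₂ - 2)² + 4Y² = 4` (`phononPoint_mem_quartic`), `(X, Y) ↦ z = (ω₂ + 2 - X²)/2 + iY = e^{ik}`. -/
def phononPoint (ω₂ k : ℝ) : ℝ × ℝ :=
  (dispersion ω₂ k, Real.sin k)

/-- Twice the signed area of the triangle `p q r` in `ℝ²` (zero iff the three points are collinear). -/
def det3 (p q r : ℝ × ℝ) : ℝ :=
  (q.1 - p.1) * (r.2 - p.2) - (q.2 - p.2) * (r.1 - p.1)

/-- `P(k) ∈ C₄`: `(ω² - ω₂ - 2)² + 4 sin² k = 4 cos² k + 4 sin² k = 4`. [folklore] -/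
theorem phononPoint_mem_quartic {ω₂ : ℝ} (hω : 0 ≤ ω₂) (k : ℝ) :
    ((phononPoint ω₂ k).1 ^ 2 - (ω₂ + 2)) ^ 2 + 4 * (phononPoint ω₂ k).2 ^ 2 = 4 := by
  have h := Real.sin_sq_add_cos_sq k
  simp only [phononPoint, dispersion_sq hω]
  linear_combination (4 : ℝ) * h

/-- The elliptic logarithm of the pinned band, `u(k) = ∫₀ᵏ dk'/ω(k')` (integral of the regular
differential `dk/ω` of `C₄`; strictly increasing, `u(k + 2π) = u(k) + u(2π)`, odd). -/
def ellipticLog (ω₂ k : ℝ) : ℝ :=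
  ∫ x in (0 : ℝ)..k, 1 / dispersion ω₂ x

/-- The VELOCITY GAP of a collision `(k₁, k₂) → (k₃, k₄ = k₁ + k₂ - k₃)`: the least of the six
differences `|v_i - v_j|` of group velocities. `0 < velocityGap` is GENERAL POSITION of the resonance
4-web at that point (pairwise transversality of the four foliations `{k_i = const}` of the resonant
surface, and `∂₂Ω = v₂ - v₄ ≠ 0`); it fails exactly on the six equal-velocity curves (grazing / fold /
exchange loci) and implies non-triviality (`k₃ ≢ k₁, k₂ mod 2π`). -/
def velocityGap (ω₂ k₁ k₂ k₃ : ℝ) : ℝ :=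
  min (min (min |groupVelocity ω₂ k₁ - groupVelocity ω₂ k₂| |groupVelocity ω₂ k₁ - groupVelocity ω₂ k₃|)
      (min |groupVelocity ω₂ k₁ - groupVelocity ω₂ (k₁ + k₂ - k₃)|
        |groupVelocity ω₂ k₂ - groupVelocity ω₂ k₃|))
    (min |groupVelocity ω₂ k₂ - groupVelocity ω₂ (k₁ + k₂ - k₃)|
      |groupVelocity ω₂ k₃ - groupVelocity ω₂ (k₁ + k₂ - k₃)|)

/-- A GENERAL-POSITION CHART of the resonant surface: an open preconnected `U ⊂ ℝ²` of pairs
`p = (k₁, k₃)` and a smooth branch `k₂ = h(k₁, k₃)` of resonant partners (`Ω(k₁, h, k₃) = 0`) along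
which all four group velocities stay pairwise distinct. (Such charts exist around every
general-position point of the non-perturbative branch by the implicit function theorem, `∂₂Ω = v₂ - v₄`.) -/
def IsResonanceChart (ω₂ : ℝ) (U : Set (ℝ × ℝ)) (h : ℝ × ℝ → ℝ) : Prop :=
  IsOpen U ∧ IsPreconnected U ∧ ContDiffOn ℝ (⊤ : ℕ∞) h U ∧
    (∀ p ∈ U, resonanceFn ω₂ p.1 (h p) p.2 = 0) ∧ (∀ p ∈ U, 0 < velocityGap ω₂ p.1 (h p) p.2)

namespace IsResonanceChart

variable {ω₂ : ℝ} {U : Set (ℝ × ℝ)} {h : ℝ × ℝ → ℝ}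

theorem isOpen (hc : IsResonanceChart ω₂ U h) : IsOpen U := hc.1

theorem isPreconnected (hc : IsResonanceChart ω₂ U h) : IsPreconnected U := hc.2.1

theorem contDiffOn (hc : IsResonanceChart ω₂ U h) : ContDiffOn ℝ (⊤ : ℕ∞) h U := hc.2.2.1

theorem resonant (hc : IsResonanceChart ω₂ U h) : ∀ p ∈ U, resonanceFn ω₂ p.1 (h p) p.2 = 0 :=
  hc.2.2.2.1

theorem generalPosition (hc : IsResonanceChart ω₂ U h) :
    ∀ p ∈ U, 0 < velocityGap ω₂ p.1 (h p) p.2 :=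
  hc.2.2.2.2

/-- Restriction of a chart to an open preconnected subset is a chart. -/
theorem mono (hc : IsResonanceChart ω₂ U h) {V : Set (ℝ × ℝ)} (hV : V ⊆ U) (hVo : IsOpen V)
    (hVc : IsPreconnected V) : IsResonanceChart ω₂ V h :=
  ⟨hVo, hVc, hc.contDiffOn.mono hV, fun p hp => hc.resonant p (hV hp),
    fun p hp => hc.generalPosition p (hV hp)⟩

end IsResonanceChart

/-! ## The six registered stubs (`sorry` lives ONLY here) -/

/-- **S1 · `stub_resonanceIsChord` — ResonanceIsChord** (algebraic half of the lever; size M).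
A non-trivial resonance `ω(k₁) + ω(k₂) = ω(k₃) + ω(k₁+k₂-k₃)` (`k₃ ≢ k₁`, `k₃ ≢ k₂ mod 2π`) makes the
phonon points `P(k₁), P(k₂), -P(k₃)` collinear (and, applying it to `(k₁, k₂, k₄)`, also `-P(k₄)`): the
four points `P₁, P₂, -P₃, -P₄` are a line section of `C₄` (`Σ X = 0` = energy, `∏ z = 1` = momentum).
PROOF ROUTE (gen 2 — CLOSED FORM, no uniqueness-of-root / convexity / Vieta-over-`Polynomial` argument; each
line below checked to `≤ 4e-12` on 1236 + 1662 bisection-found resonances incl. the near-degenerate corners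
`k₂ ≈ ±k₁`, planner folder `num/s1_poly.py`, `num/s1_closed.py`). Notation: `X_j = ω(k_j)`, `s_j = sin k_j`,
`c = ω₂ + 2`, `K = k₁ + k₂`, `δ = (k₁ - k₂)/2` (so `k₁ = K/2 + δ`, `k₂ = K/2 - δ`), `E = X₁ + X₂ > 0`,
`φ = k₃ - K/2`, `X₃ = ω(k₃)`, `X₄ = ω(K - k₃)`, `S = sin(K/2)`, `C = cos(K/2)`.
(a) RESONANCE ⇒ `Q(cos φ) = 0`, `Q(x) := 4S²x² - 2E²Cx + (cE² - E⁴/4 - 4S²)`. [`X₃² - X₄² = 2(cos(K-k₃) - cos k₃)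
  = 4S sin φ` (`dispersion_sq`, `Real.cos_sub_cos`); divide by `X₃ + X₄ = E`: `2X₃ = E + 4S sin φ/E`,
  `2X₄ = E - 4S sin φ/E`; compare `4X₃X₄ = E² - 16S² sin²φ/E²` with `2X₃X₄ = E² - X₃² - X₄² = E² - 2c + 4C cos φ`.]
(b) RESONANCE ⇒ `E · det3(P₁, P₂, -P₃) = sin δ · L(cos φ)`, `L(x) := 4S²(x + cos δ) - 2E²C`. [`det3(P₁,P₂,-P₃)
  = (s₂-s₁)(X₃+X₁) - (X₂-X₁)(s₃+s₁)`; insert `E X₃` from (a), `s₃ = sin φ · C + cos φ · S`,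
  `s₂ - s₁ = -2C sin δ`, `s₁ = S cos δ + C sin δ`, `E(X₂ - X₁) = X₂² - X₁² = 2(cos k₁ - cos k₂) = -4S sin δ`:
  the `sin φ`-terms cancel identically (`2(s₂-s₁)S = E(X₂-X₁)C`, both `= -4SC sin δ`) and the remainder is
  `sin δ · L(cos φ)`. On a resonance therefore `det3 = (4/E) sin δ · S² · (cos φ - γ)`,
  `γ := E²C/(2S²) - cos δ` when `S ≠ 0`.]
(c) IDENTITY (all `k₁, k₂, x`): `Q(x) = (x - cos δ) · L(x)`. [The difference is
  `cE² - E⁴/4 - 4S² sin²δ - 2E²C cos δ = -(E⁴ - 2E²(X₁² + X₂²) + (X₁² - X₂²)²)/4` (use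
  `cos k₁ + cos k₂ = 2C cos δ`, `cos k₁ - cos k₂ = -2S sin δ`, `X_j² = c - 2cos k_j`), and with `E = X₁ + X₂`
  that bracket is `(X₁+X₂)²[(X₁+X₂)² - 2(X₁²+X₂²) + (X₁-X₂)²] = 0` — `ring`.]
(d) Hence on a resonance `E · det3 · (cos φ - cos δ) = sin δ · Q(cos φ) = 0`; `cos φ = cos δ ⇔ φ ≡ ±δ ⇔
  k₃ ≡ k₁ or k₂ (mod 2π)` (`Real.cos_eq_cos_iff`) is excluded by the hypotheses and `E > 0`
  (`dispersion_pos`), so `det3 = 0`. ∎  No case split on `S = 0` or `sin δ = 0` is needed in this form.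
(a′), (a), (b), (c), (d) are KERNEL-CHECKED below in abstract variables (`S1Route.two_E_X₃_eq`,
`S1Route.Q_root_of_resonance`, `S1Route.E_mul_det3_eq`, `S1Route.Q_eq_mul_L`, `S1Route.det_eq_zero_of`,
all by `linear_combination`); what remains for the prover is the trigonometric dictionary
(`k₁ = K/2 + δ`, `k₂ = K/2 - δ`, `k₃ = K/2 + φ` into `Real.cos_add` etc.), `dispersion_sq` and the
`mod 2π` bookkeeping of `Real.cos_eq_cos_iff`.
By-product (explicit non-trivial branch, for S4/S5/S6 and the other lines): in the `(k₁,k₂)`-chart the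
out-pair is `k₃,₄ = K/2 ± arccos γ` (none if `|γ| > 1`); in the `(k₁,k₃)`-chart (`K' = k₁ - k₃`, `E' = X₁ - X₃`)
the same algebra gives `cos(k₂ + K'/2) = γ' := cos(K'/2)E'²/(2 sin²(K'/2)) - cos((k₁+k₃)/2)`, exactly one of
the two signs being a root of `Ω(k₁, ·, k₃)` (the other is the squaring artefact `k₂ ↦ -k₄`), so
`resonantSet ω₂ k₁ k₃ = {k₃, h(k₁,k₃)}` off the diagonal with `h` real-analytic where `|γ'| < 1`
(`num/explicit_branch.py`: agrees with root scanning to `3e-12` on 1500 cells, `ω₂ ∈ {0.05,…,25}`).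
Leans on: `dispersion_sq`, `dispersion_pos`, `resonanceFn_eq_zero_iff`, `Real.cos_sub_cos`, `Real.cos_add_cos`,
`Real.sin_sub_sin`, `Real.sin_add`, `Real.cos_eq_cos_iff`, `ring`/`nlinarith`. Honours
`crux_false_without_omegaPos` (`0 < ω₂`: `E > 0`, `dispersion_sq`). -/
theorem stub_resonanceIsChord :
    ∀ ω₂ : ℝ, 0 < ω₂ → ∀ k₁ k₂ k₃ : ℝ, resonanceFn ω₂ k₁ k₂ k₃ = 0 →
      (∀ n : ℤ, k₃ - k₁ ≠ 2 * π * n) → (∀ n : ℤ, k₃ - k₂ ≠ 2 * π * n) →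
        det3 (phononPoint ω₂ k₁) (phononPoint ω₂ k₂) (-(phononPoint ω₂ k₃)) = 0 := by
  sorry

/-- **S2 · `stub_antiInvariant_of_chord` — the elliptic logarithm is an ANTI-invariant** (calculus half
of the lever; size M). If the chord property S1 holds at `ω₂`, then along every general-position chart
`(U, h)` the sum `u(k₁) + u(h) + u(k₃) + u(k₁ + h - k₃)` is CONSTANT (sign pattern `(+,+,+,+)`, so `u` can
never be a collisional invariant). Proof sketch: `u' = 1/ω` (FTC, `ω > 0` continuous), `h ∈ C^∞(U)` with
`∂₁h = (v₄ - v₁)/(v₂ - v₄)`, `∂₃h = (v₃ - v₄)/(v₂ - v₄)` from differentiating `Ω(k₁, h, k₃) = 0`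
(`hasDerivAt_resonanceFn`; `v₂ ≠ v₄` by general position); both partial derivatives of the sum vanish
iff `(v₁, 1/ω₁), (v₂, 1/ω₂), (v₃, -1/ω₃), (v₄, -1/ω₄)` are collinear, which is S1 (at `(k₁,k₂,k₃)` and
`(k₁,k₂,k₄)`; non-triviality from `0 < velocityGap`) transported by the projective map
`(X, Y) ↦ (Y/X, 1/X)`; zero gradient on an open preconnected set ⇒ constant. Checked numerically to `1e-14`
(num/sanity.py). Leans on: `intervalIntegral.integral_hasDerivAt_right`, `hasDerivAt_dispersion`,
`hasDerivAt_resonanceFn`, `ContDiffOn.differentiableOn`, `IsPreconnected` + `IsOpen.is_const_of_fderiv_eq_zero`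
-type lemmas (`IsLocallyConstant`). -/
theorem stub_antiInvariant_of_chord :
    ∀ ω₂ : ℝ, 0 < ω₂ →
      (∀ k₁ k₂ k₃ : ℝ, resonanceFn ω₂ k₁ k₂ k₃ = 0 →
        (∀ n : ℤ, k₃ - k₁ ≠ 2 * π * n) → (∀ n : ℤ, k₃ - k₂ ≠ 2 * π * n) →
          det3 (phononPoint ω₂ k₁) (phononPoint ω₂ k₂) (-(phononPoint ω₂ k₃)) = 0) →
      ∀ (U : Set (ℝ × ℝ)) (h : ℝ × ℝ → ℝ), IsResonanceChart ω₂ U h →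
        ∃ C : ℝ, ∀ p ∈ U,
          ellipticLog ω₂ p.1 + ellipticLog ω₂ (h p) + ellipticLog ω₂ p.2 +
            ellipticLog ω₂ (p.1 + h p - p.2) = C := by
  sorry

/-- **S3 · `stub_abelBolSpan` — Abel–Bol span of the resonance 4-web** (the line's own deep input; size L,
but ELEMENTARY by the gen-2 route below — no web geometry, no analyticity, no flatness issue). On a
general-position chart `(U, h)` carrying the anti-invariant (S2), every SMOOTH abelian relation
`g₁(k₁) + g₂(k₂) + g₃(k₃) + g₄(k₄) = 0` (`k₂ = h`, `k₄ = k₁ + k₂ - k₃`) is a combination of `R_k = (k, k, -k, -k)`,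
`R_ω = (ω, ω, -ω, -ω)`, `R_u = (u, u, u, u)` and constants (Bol's bound: rank ≤ 3 for a planar 4-web in general
position; Abel's theorem on the tacnodal quartic explains the three relations, `⟨1, X, Y⟩dX/F_Y = ⟨du, dk, dω⟩/8`).
PROOF ROUTE (gen 2 — second-order finite-type closure; write `x = k₁ = p.1`, `y = k₃ = p.2`, `h = h(x,y)`,
`k₄ = x + h - y`, `G := g₂' ∘ h`, `H := g₄' ∘ k₄`, `H₁ := g₄'' ∘ k₄` as functions on `U`):
(1) `∂x∂y` of the relation kills `g₁(x)` and `g₃(y)` and leaves, on `U`,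
  `(E1)  h_x h_y · (g₂''∘h) + h_xy · G + (1 + h_x)(h_y - 1) · H₁ + h_xy · H = 0`.
  General position is EXACTLY the non-vanishing of its coefficients: `h_x = (v₄-v₁)/(v₂-v₄) ≠ 0`,
  `h_y = (v₃-v₄)/(v₂-v₄) ≠ 0`, `1 + h_x = (v₂-v₁)/(v₂-v₄) ≠ 0`, `h_y - 1 = (v₃-v₂)/(v₂-v₄) ≠ 0`, and
  `dk₂ ∧ dk₄ = -(h_x + h_y) dx∧dy ≠ 0 ⇔ v₁ ≠ v₃` (checked against finite differences, `num/s3_closure.py`: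
  (E1) holds for `R_ω`, `R_u` to FD accuracy `1e-6` at 75 chart points, `ω₂ ∈ {0.2, 1, 4}`).
(2) (E1) solves `g₂''∘h = -(h_xy G + (1+h_x)(h_y-1) H₁ + h_xy H)/(h_x h_y)`, so `dG = (g₂''∘h) dh` is linear in
  the STATE `s := (G, H, H₁)`; `dH = H₁ dk₄`; and since `g₂''∘h` is a function of `h` alone,
  `d(g₂''∘h) ∧ dh = 0` — its only term containing `g₄'''∘k₄` is `-(1+h_x)(h_y-1)/(h_x h_y) · (g₄'''∘k₄) dk₄ ∧ dh`
  with `dk₄ ∧ dh ≠ 0`, so `g₄'''∘k₄`, hence `dH₁ = (g₄'''∘k₄) dk₄`, is linear in `s` with smooth coefficients.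
  Thus `ds = Γ s` for a continuous matrix of 1-forms `Γ` on `U` (a linear total differential system of rank 3).
(3) Along any `C¹` path in `U`, `s` solves a linear ODE; `s(p₀) = 0 ⇒ s ≡ 0` on the (path-)connected open `U`
  (Grönwall / `ODE_solution_unique`-type uniqueness). Hence the solution space has dimension ≤ 3, and the map
  relation ↦ `s` has kernel = constants (`G ≡ H ≡ 0` ⇒ `g₂, g₄` constant on the slot images, then
  `g₁(x) + g₃(y) ≡ const` on `U` ⇒ `g₁, g₃` constant on the (preconnected) projections).
(4) `R_k, R_ω, R_u` ARE relations on `U` (momentum is built into `k₄`; energy = `resonant`; `R_u` = the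
  hypothesis) and are independent modulo constants (`α + βv + γ/ω ≡ 0` on an interval ⇒ `αω + β sin k + γ ≡ 0`,
  analytic, at `k = 0, π`: `α√ω₂ + γ = α√(ω₂+4) + γ = 0` ⇒ `α = γ = 0 = β`), so `dim(relations/constants) ≤ 3`
  (state map injective modulo constants, evaluation at `p₀` injective on states) is attained by them and every
  relation is `αR_k + βR_ω + γR_u +` constants, with ONE `(α, β, γ)` on the preconnected `U` and the four
  constants `c_i` read off slotwise. `C³` relations and a `C³` branch suffice; the stub keeps `C^∞`.
(The classical vanishing-order filtration — graded pieces inject into `ker((c_i) ↦ Σ c_i (dk_i)^j ∈ SʲT*)` of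
dimensions `2, 1, 0, …` — gives the same bound but needs "flat relation ⇒ zero", which (2)–(3) supply; the
prolongation test of gen 1, `evidence-prolongation.md`: exactly three null singular values at 8 points, orders
5–8, is the numerical shadow of (2).) Why it might fail: only through a hidden degeneracy of the web, excluded by
`0 < velocityGap`. Leans on: `ContDiff.differentiable`, `fderiv`/`deriv` chain rules, `IsOpen.isConnected`-path
arguments (`IsPreconnected`, `JoinedIn`), `ODE_solution_unique_of_mem_Icc_right` /
`norm_le_gronwallBound_of_norm_deriv_right_le` (Mathlib/Analysis/ODE), `LinearIndependent`; background refs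
Pereira–Pirio (arXiv:1107.0595) Ch. 2–3, Hénaut 2004 (doi:10.4007/annals.2004.159.425), Blaschke–Bol 1938. -/
theorem stub_abelBolSpan :
    ∀ ω₂ : ℝ, 0 < ω₂ → ∀ (U : Set (ℝ × ℝ)) (h : ℝ × ℝ → ℝ), IsResonanceChart ω₂ U h →
      (∃ C : ℝ, ∀ p ∈ U,
          ellipticLog ω₂ p.1 + ellipticLog ω₂ (h p) + ellipticLog ω₂ p.2 +
            ellipticLog ω₂ (p.1 + h p - p.2) = C) →
      ∀ g₁ g₂ g₃ g₄ : ℝ → ℝ, ContDiff ℝ (⊤ : ℕ∞) g₁ → ContDiff ℝ (⊤ : ℕ∞) g₂ →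
        ContDiff ℝ (⊤ : ℕ∞) g₃ → ContDiff ℝ (⊤ : ℕ∞) g₄ →
        (∀ p ∈ U, g₁ p.1 + g₂ (h p) + g₃ p.2 + g₄ (p.1 + h p - p.2) = 0) →
        ∃ α β γ c₁ c₂ c₃ c₄ : ℝ, ∀ p ∈ U,
          g₁ p.1 = α * p.1 + β * dispersion ω₂ p.1 + γ * ellipticLog ω₂ p.1 + c₁ ∧
          g₂ (h p) = α * h p + β * dispersion ω₂ (h p) + γ * ellipticLog ω₂ (h p) + c₂ ∧
          g₃ p.2 = -(α * p.2) - β * dispersion ω₂ p.2 + γ * ellipticLog ω₂ p.2 + c₃ ∧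
          g₄ (p.1 + h p - p.2) = -(α * (p.1 + h p - p.2)) - β * dispersion ω₂ (p.1 + h p - p.2) +
            γ * ellipticLog ω₂ (p.1 + h p - p.2) + c₄ := by
  sorry

/-- **S4 · `stub_gluing` — propagation / gluing** (size M/L; the step the triage panel corrected: the LOCAL
statement "invariant on a small piece ⇒ affine in ω" is FALSE — `αk + βω ± γu + c` IS a local invariant — so
`γ = 0` and `α = 0` are global facts). If the chartwise span property (conclusion of S3, for every
general-position chart) holds at `ω₂`, then every smooth `2π`-periodic `ψ` satisfying the collision identity
at all GENERAL-POSITION resonances is `c + dω`. Proof sketch: for `k` outside a finite set (`±k_m`, where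
`v' = 0`; `v' = -(cos k - c₋)(cos k - c₊)/ω³`, `c₊c₋ = 1`, `c₊ > 1 > c₋ = cos k_m`, so the zeros are simple and
`v''(k_m) ≠ 0`) the near-grazing branch `k₂ = H(k, t)` of `Ω(k, k₂, k + t) = t·G = 0`,
`G(k, k₂, t) = (v(k₂) - v(k)) - (v'(k) + v'(k₂)) t/2 + O(t²)`, is smooth by the IFT at `k₂ = k*` (the
velocity-conjugate point, `v(k*) = v(k)`; `∂G/∂k₂ = v'(k*) ≠ 0 ⇔ k ≠ ±k_m`), with `H = k* + a t + O(t²)`,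
`a = (1 + σ)/2`, `σ := v'(k)/v'(k*) < 0` (`v'` has opposite signs at `k` and `k*`); alternatively `H` is EXPLICIT
by S1's by-product formula (`cos(k₂ + K'/2) = γ'`, `K' = -t`). To first order in `t` the six velocity
differences along this family are `v₁ - v₃ = -v'(k)t`, `v₂ - v₄ = v'(k*)t`, `v₁ - v₂ = -v'(k*)·a·t`,
`v₁ - v₄ = -v'(k*)(a - 1)t`, `v₃ - v₂ = (v'(k) - v'(k*))t/2`, `v₃ - v₄ = (v'(k) + v'(k*))t/2` (+ `O(t²)`), all
non-zero for small `t ≠ 0` as soon as `k ∉ {±k_m}` and `v'(k) + v'(k*) ≠ 0` (`σ ≠ -1`; `σ ≠ 0, 1` is automatic);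
`Z(k) := v'(k) + v'(k*)` is real-analytic on `(0, k_m) ∪ (k_m, π)`, `Z(0+) > 0`, numerically `≠ 0` there
(TRIAGE-r1-1 tri.py B, 11 values of `ω₂`), and in any case has finitely many zeros, which is all that is used.
So small boxes `k ∈ I`, `t ∈ (t₀, t₁)` (`0 < t₀ < t₁ < |I|`) off finitely many `k` are general-position charts;
apply the span property to `(ψ, ψ, -ψ, -ψ)`: on the slot-1 projection `I`, `ψ = αk + βω + γu + c₁`; on the
OVERLAPPING slot-3 projection `I + (t₀, t₁)`, `ψ = αk + βω - γu - c₃` ⇒ `γ = 0` (`u` strictly increasing;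
triage r1-3); overlapping boxes ⇒ one `(α, β, c)` on each arc of `𝕋` minus finitely many points (`1, k, ω`
independent on intervals); across an exceptional point `k_e`, `ψ ∈ C³` matches the two sides: `ψ''` gives
`β₁ = β₂` if `v'(k_e) ≠ 0`, and at `k_e = ±k_m` (`v' = 0`) `ψ''' = βv''` with `v''(k_m) ≠ 0` does; then
`ψ(k + 2π) = ψ(k)` ⇒ `α = 0` — the non-periodic null vector `k ↦ k` of `hasOddSectorGap_false_without_periodic`
is exactly the relation `R_k` that periodicity removes. Leans on: `HasStrictFDerivAt.implicitFunction` /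
`ImplicitFunctionData`, or the tree's analytic version `Literature/Analysis/Calculus/ImplicitChart.lean`
(`analyticAt_implicitFunction`), or S1's explicit branch; `hasDerivAt_dispersion`, `groupVelocity`, gen-1's
unimodality of `groupVelocity` (evidence FGRGapOddInvariant.lean: `StrictMonoOn [0,k_m]`, `StrictAntiOn [k_m,π]`),
`Function.Periodic`, `IsPreconnected`, S3's output shape. -/
theorem stub_gluing :
    ∀ ω₂ : ℝ, 0 < ω₂ →
      (∀ (U : Set (ℝ × ℝ)) (h : ℝ × ℝ → ℝ), IsResonanceChart ω₂ U h →
        ∀ g₁ g₂ g₃ g₄ : ℝ → ℝ, ContDiff ℝ (⊤ : ℕ∞) g₁ → ContDiff ℝ (⊤ : ℕ∞) g₂ →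
        ContDiff ℝ (⊤ : ℕ∞) g₃ → ContDiff ℝ (⊤ : ℕ∞) g₄ →
        (∀ p ∈ U, g₁ p.1 + g₂ (h p) + g₃ p.2 + g₄ (p.1 + h p - p.2) = 0) →
        ∃ α β γ c₁ c₂ c₃ c₄ : ℝ, ∀ p ∈ U,
          g₁ p.1 = α * p.1 + β * dispersion ω₂ p.1 + γ * ellipticLog ω₂ p.1 + c₁ ∧
          g₂ (h p) = α * h p + β * dispersion ω₂ (h p) + γ * ellipticLog ω₂ (h p) + c₂ ∧
          g₃ p.2 = -(α * p.2) - β * dispersion ω₂ p.2 + γ * ellipticLog ω₂ p.2 + c₃ ∧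
          g₄ (p.1 + h p - p.2) = -(α * (p.1 + h p - p.2)) - β * dispersion ω₂ (p.1 + h p - p.2) +
            γ * ellipticLog ω₂ (p.1 + h p - p.2) + c₄) →
      ∀ ψ : ℝ → ℝ, ContDiff ℝ (⊤ : ℕ∞) ψ → Function.Periodic ψ (2 * π) →
        (∀ k₁ k₂ k₃ : ℝ, resonanceFn ω₂ k₁ k₂ k₃ = 0 → 0 < velocityGap ω₂ k₁ k₂ k₃ →
          ψ k₁ + ψ k₂ = ψ k₃ + ψ (k₁ + k₂ - k₃)) →
        ∃ c d : ℝ, ∀ k : ℝ, ψ k = c + d * dispersion ω₂ k := by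
  sorry

/-- **S5 · `stub_bootstrap` — `L² → C^∞` bootstrap of null vectors** (size L; the one regularity step
common to all lines, LS08 §5 device). For `0 < ω₂`, `0 < a`, `0 ≤ b`: a `2π`-periodic measurable `f` with
`‖f‖² < ∞` and `q(f) = 0` is a.e. equal to a smooth `2π`-periodic `ψ` satisfying the collision identity at
every general-position resonance. Proof sketch: `q(f) = 0` ⇒ for a.e. `(k₁, k₃)` and every resonant `k₂`
with `w > 0` the bracket vanishes (`resonantSet_finite`; `w > 0` off the null sets `{v₂ = v₄}` (Jacobian junk)
and `{Φ = 0}` (an analytic curve at most, only if `a ≤ 4b`; `Φ ≥ a > 0` at grazing)); average the a.e.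
identity `f(k₁) = f(k₃) + f(k₄) - f(k₂)` against a bump in `k₃` over a general-position window: the changes
of variables `k₃ ↦ k₂ = h` (`∂₃h = (v₃-v₄)/(v₂-v₄) ≠ 0`) and `k₃ ↦ k₄` (`∂₃k₄ = (v₃-v₂)/(v₂-v₄) ≠ 0`) are
smooth local diffeomorphisms BY the velocity inequalities, so the right side is `C^∞` in `k₁`; such windows
exist for every `k₁` (Disproof.lean §3(C): `∂₃h` has two transversal zeros per row, `∂₃h ≠ 1` everywhere);
the smooth representative satisfies the identity at every general-position resonance by continuity (local
IFT graph; `f ∘ h = ψ ∘ h` a.e. because `∇h ≠ 0` pulls null sets back to null sets), and `f = ψ` a.e. on `ℝ`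
by periodicity of both. The branch is now CLOSED-FORM (S1 by-product, gen 2): off the diagonal
`resonantSet ω₂ k₁ k₃ = {k₃, h(k₁,k₃)}` with `cos(h + (k₁-k₃)/2) = cos((k₁-k₃)/2)(ω₁-ω₃)²/(2sin²((k₁-k₃)/2))
- cos((k₁+k₃)/2)`, the sign of the `arccos` fixed by `Ω = 0` (empty second element when the modulus exceeds
1), so the `finsum` in `boltzmannForm` is the single `h`-term (the exchange term is zero,
`exchange_term_eq_zero`) and `h` is real-analytic on the open set where the modulus is `< 1` — no IFT needed
for the chart maps. `0 < b` unnecessary, `0 ≤ b` kept (`onsite_of_crux`). Leans on: `resonantSet_finite`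
(PinnedChainResonantFinite), `lintegral_eq_zero_iff'`, `ae_restrict_iff'`,
`MeasureTheory.integral_image_eq_integral_abs_deriv_smul`, `hasFDerivAt_integral_of_dominated_of_fderiv_le`,
`Real.arccos` / `Real.cos_arccos`, `HasStrictFDerivAt.implicitFunction` (fallback). -/
theorem stub_bootstrap :
    ∀ ω₂ a b : ℝ, 0 < ω₂ → 0 < a → 0 ≤ b → ∀ f : ℝ → ℝ, Function.Periodic f (2 * π) →
      Measurable f → cellNormSq f < ∞ → boltzmannForm ω₂ a b f = 0 →
        ∃ ψ : ℝ → ℝ, ContDiff ℝ (⊤ : ℕ∞) ψ ∧ Function.Periodic ψ (2 * π) ∧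
          (∀ k₁ k₂ k₃ : ℝ, resonanceFn ω₂ k₁ k₂ k₃ = 0 → 0 < velocityGap ω₂ k₁ k₂ k₃ →
          ψ k₁ + ψ k₂ = ψ k₃ + ψ (k₁ + k₂ - k₃)) ∧
          f =ᵐ[volume] ψ := by
  sorry

/-- **S6 · `stub_weylReduction` — coercivity given no odd null vector** (size L analysis / XL Lean; the
"one analytic estimate left" of Disproof.lean §4; verbatim the shape `GapOfNoOddNullVector` endorsed by the
triage panel, so one proof serves every classification line). For `0 < ω₂`, `0 < a`, `0 ≤ b`: if every odd
`2π`-periodic measurable `L²` null vector of `q` has norm zero, the odd-sector gap holds. Proof sketch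
(Lukkarinen2016 §3.4 made honest; fold-jet's lsc-free architecture): suppose the odd infimum is `0`; take
odd `f_n`, `‖f_n‖ = 1`, `q(f_n) → 0`; truncate the kernel to `{velocityGap ≥ ε}`: there `|∂₂Ω| ≥ ε` and all
six change-of-variable Jacobians are ratios of velocity differences bounded above and below, so
`q ≥ q_ε = ⟨f, V_ε f⟩ - ⟨f, K_ε f⟩` (`boltzmannForm_mono_weight`) with `K_ε` Hilbert–Schmidt and
`V_ε ≥ v₀(ε) > 0` for small `ε` — HERE `0 < a` is used (every fibre keeps collisions of positive weight; at
`a = 0` the fibre `k = 0` is dead: the disprover's near-miss `not_hasOddSectorGap_zero_onsite`); a weak limit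
`f` of the `f_n` has `⟨f, K_ε f⟩ ≥ v₀ > 0`, so `f ≠ 0`, is odd periodic `L²`, and
`q_ε'(f) ≤ liminf q_ε'(f_n) ≤ liminf q(f_n) = 0` for every `ε'` (bounded non-negative forms are weakly lsc),
whence `q(f) = sup_ε' q_ε'(f) = 0` (monotone convergence) — contradicting the hypothesis. The gap constant
depends on `(ω₂, a, b)` (`no_uniform_gap`). Leans on: `MeasureTheory.Lp` / `MemLp`, weak sequential
compactness of the `L²` ball, `IsCompactOperator` (Hilbert–Schmidt), `lintegral_iSup` (monotone convergence),
`boltzmannForm_mono_weight`, `hasOddSectorGap_of_weight_le` (landed, OnsiteReduction). -/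
theorem stub_weylReduction :
    ∀ ω₂ a b : ℝ, 0 < ω₂ → 0 < a → 0 ≤ b →
      (∀ f : ℝ → ℝ, Function.Periodic f (2 * π) → Measurable f → Function.Odd f →
        cellNormSq f < ∞ → boltzmannForm ω₂ a b f = 0 → cellNormSq f = 0) →
      HasOddSectorGap ω₂ a b := by
  sorry

/-! ## Proved building blocks for S1 (gen 2; sorry-free, `linear_combination`)

The polynomial identities (a′), (a), (b), (c) and the concluding step (d) of the S1 route, KERNEL-CHECKED in
abstract real variables under the dictionary `X_j = ω(k_j)`, `E = X₁ + X₂`, `S = sin(K/2)`, `C = cos(K/2)`,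
`sd = sin δ`, `cd = cos δ`, `sφ = sin φ`, `cφ = cos φ`, `c = ω₂ + 2` (so `cos k₁ = C cd - S sd`,
`cos k₂ = C cd + S sd`, `sin k₁ = S cd + C sd`, `sin k₂ = S cd - C sd`, `sin k₃ = sφ C + cφ S` by
`Real.cos_add/cos_sub/sin_add/sin_sub` with `k₁ = K/2 + δ`, `k₂ = K/2 - δ`, `k₃ = K/2 + φ`). What is left of S1
for the prover is exactly this trigonometric dictionary, `dispersion_sq`, and `Real.cos_eq_cos_iff`. -/
namespace S1Route

/-- **(a′)** from `X₃ + X₄ = E` and `X₃² - X₄² = 4 S sin φ`: `2 E X₃ = E² + 4 S sin φ`, `2 E X₄ = E² - 4 S sin φ`. -/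
theorem two_E_X₃_eq (E X₃ X₄ S sφ : ℝ) (hsum : X₃ + X₄ = E) (hdiff : X₃ ^ 2 - X₄ ^ 2 = 4 * S * sφ) :
    2 * E * X₃ = E ^ 2 + 4 * S * sφ ∧ 2 * E * X₄ = E ^ 2 - 4 * S * sφ := by
  constructor
  · linear_combination hdiff + (E + X₄ - X₃) * hsum
  · linear_combination (E + X₃ - X₄) * hsum - hdiff

/-- **(a)** the `cos φ`-quadratic of a resonance: `Q(cos φ) = 0`,
`Q(x) = 4S²x² - 2E²Cx + (cE² - E⁴/4 - 4S²)`, from (a′), `X₃² + X₄² = 2c - 4C cos φ` and `X₃ + X₄ = E`. -/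
theorem Q_root_of_resonance (E X₃ X₄ S C sφ cφ c : ℝ)
    (h3 : 2 * E * X₃ = E ^ 2 + 4 * S * sφ) (h4 : 2 * E * X₄ = E ^ 2 - 4 * S * sφ)
    (hsq : X₃ ^ 2 + X₄ ^ 2 = 2 * c - 4 * C * cφ) (hsum : X₃ + X₄ = E) (hP : sφ ^ 2 + cφ ^ 2 = 1) :
    4 * S ^ 2 * cφ ^ 2 - 2 * E ^ 2 * C * cφ + (c * E ^ 2 - E ^ 4 / 4 - 4 * S ^ 2) = 0 := by
  have hprod : 4 * E ^ 2 * (X₃ * X₄) = E ^ 4 - 16 * S ^ 2 * sφ ^ 2 := by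
    linear_combination (2 * E * X₄) * h3 + (E ^ 2 + 4 * S * sφ) * h4
  have hprod2 : 2 * (X₃ * X₄) = E ^ 2 - 2 * c + 4 * C * cφ := by
    linear_combination (X₃ + X₄ + E) * hsum - hsq
  have key : E ^ 2 * (E ^ 2 - 2 * c + 4 * C * cφ) = (E ^ 4 - 16 * S ^ 2 * sφ ^ 2) / 2 := by
    linear_combination -(E ^ 2) * hprod2 + hprod / 2
  linear_combination (-1 / 2 : ℝ) * key + 4 * S ^ 2 * hP

/-- **(b)** on a resonance (via (a′)) and with `X₂² - X₁² = 2(cos k₁ - cos k₂) = -4 S sin δ`: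
`E · det3(P₁, P₂, -P₃) = sin δ · L(cos φ)`, `L(x) = 4S²(x + cos δ) - 2E²C`, where
`det3(P₁,P₂,-P₃) = (s₂ - s₁)(X₃ + X₁) - (X₂ - X₁)(s₃ + s₁)` (unfold `det3`, `phononPoint`). -/
theorem E_mul_det3_eq (X₁ X₂ X₃ S C sd cd sφ cφ : ℝ)
    (hX3 : 2 * (X₁ + X₂) * X₃ = (X₁ + X₂) ^ 2 + 4 * S * sφ)
    (hdX : X₂ ^ 2 - X₁ ^ 2 = -4 * S * sd) :
    (X₁ + X₂) * (((S * cd - C * sd) - (S * cd + C * sd)) * (X₃ + X₁)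
        - (X₂ - X₁) * ((sφ * C + cφ * S) + (S * cd + C * sd)))
      = sd * (4 * S ^ 2 * (cφ + cd) - 2 * (X₁ + X₂) ^ 2 * C) := by
  linear_combination (-(C * sd)) * hX3 + (-(sφ * C + cφ * S + S * cd)) * hdX

/-- **(c)** `Q(x) = (x - cos δ) · L(x)` for every `x`, from `2cos k_j = c - X_j²` and `sin²δ + cos²δ = 1`. -/
theorem Q_eq_mul_L (X₁ X₂ S C sd cd x c : ℝ)
    (hc1 : 2 * (C * cd - S * sd) = c - X₁ ^ 2) (hc2 : 2 * (C * cd + S * sd) = c - X₂ ^ 2)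
    (hP : sd ^ 2 + cd ^ 2 = 1) :
    4 * S ^ 2 * x ^ 2 - 2 * (X₁ + X₂) ^ 2 * C * x
        + (c * (X₁ + X₂) ^ 2 - (X₁ + X₂) ^ 4 / 4 - 4 * S ^ 2)
      = (x - cd) * (4 * S ^ 2 * (x + cd) - 2 * (X₁ + X₂) ^ 2 * C) := by
  linear_combination (4 * S ^ 2) * hP
    + (-((X₁ + X₂) ^ 2) / 2 + S * sd - (X₂ ^ 2 - X₁ ^ 2) / 4) * hc1
    + (-((X₁ + X₂) ^ 2) / 2 - S * sd + (X₂ ^ 2 - X₁ ^ 2) / 4) * hc2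

/-- **(d)** `E·D·(x - cd) = sd·Q`, `Q = 0`, `E ≠ 0`, `x ≠ cd` ⇒ `D = 0`. -/
theorem det_eq_zero_of (E D x cd sd Q : ℝ) (hE : E ≠ 0) (hx : x ≠ cd) (hQ : Q = 0)
    (h : E * D * (x - cd) = sd * Q) : D = 0 := by
  rw [hQ, mul_zero] at h
  rcases mul_eq_zero.mp h with h1 | h1
  · rcases mul_eq_zero.mp h1 with h2 | h2
    · exact absurd h2 hE
    · exact h2
  · exact absurd (sub_eq_zero.mp h1) hx

end S1Route

/-! ## Proved building blocks for S2 (gen 2; sorry-free): gradient of `Σu` versus chord determinants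

With `w_i = 1/ω_i = u'(k_i)` and `v_i` the group velocities, `∂₁h = (v₄-v₁)/(v₂-v₄)`, `∂₃h = (v₃-v₄)/(v₂-v₄)`:
`(v₂-v₄)·∂₁(Σu) = N₁`, `(v₂-v₄)·∂₃(Σu) = N₃` below, and `N₁`, `N₃` ARE (minus) the collinearity determinants of
the projective images `(Y/X, 1/X)` of `P₁, P₂, -P₄` resp. `P₂, -P₃, -P₄`; the projective map rescales `det3` by
`X₁X₂X₃` (last lemma), so S1 ⇒ `∇(Σu) = 0` on a general-position chart. -/
namespace S2Route

/-- `(v₂-v₄)∂₁(Σu) = (w₁+w₄)(v₂-v₄) + (w₂+w₄)(v₄-v₁) = -det3 (v₁,w₁) (v₂,w₂) (v₄,-w₄)`. -/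
theorem grad₁_numerator_eq (w₁ w₂ w₄ v₁ v₂ v₄ : ℝ) :
    (w₁ + w₄) * (v₂ - v₄) + (w₂ + w₄) * (v₄ - v₁) = -det3 (v₁, w₁) (v₂, w₂) (v₄, -w₄) := by
  unfold det3; ring

/-- `(v₂-v₄)∂₃(Σu) = (w₂+w₄)(v₃-v₄) + (w₃-w₄)(v₂-v₄) = -det3 (v₂,w₂) (v₃,-w₃) (v₄,-w₄)`. -/
theorem grad₃_numerator_eq (w₂ w₃ w₄ v₂ v₃ v₄ : ℝ) :
    (w₂ + w₄) * (v₃ - v₄) + (w₃ - w₄) * (v₂ - v₄) = -det3 (v₂, w₂) (v₃, -w₃) (v₄, -w₄) := by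
  unfold det3; ring

/-- The projective map `(X, Y) ↦ (Y/X, 1/X)` (homogeneous `(X:Y:1) ↦ (Y:1:X)`) multiplies `det3` by
`(X₁X₂X₃)⁻¹`; in particular it preserves collinearity of points with `X_i ≠ 0` (`X = ±ω ≠ 0`). -/
theorem det3_projective (X₁ Y₁ X₂ Y₂ X₃ Y₃ : ℝ) (h₁ : X₁ ≠ 0) (h₂ : X₂ ≠ 0) (h₃ : X₃ ≠ 0) :
    det3 (Y₁ / X₁, 1 / X₁) (Y₂ / X₂, 1 / X₂) (Y₃ / X₃, 1 / X₃) * (X₁ * X₂ * X₃)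
      = det3 (X₁, Y₁) (X₂, Y₂) (X₃, Y₃) := by
  unfold det3
  field_simp
  ring

end S2Route

/-! ## Name-keyed statements of the stubs (the hypotheses of the composition, BY NAME)

`#h21_check_skeleton` admits as hypotheses of `FGRGap_of` only registered obligations / declared stubs by
name; each `Registered.stub_X : Prop` below is the statement of `stub_X` VERBATIM (gen 1 generated both from
one source string per stub; gen 2 changed docstrings only — and the identity is checked definitionally by the
`example`s that follow). -/
namespace Registered

/-- Statement of `stub_resonanceIsChord` (verbatim), keyed by the registered stub name. -/
abbrev stub_resonanceIsChord : Prop :=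
    ∀ ω₂ : ℝ, 0 < ω₂ → ∀ k₁ k₂ k₃ : ℝ, resonanceFn ω₂ k₁ k₂ k₃ = 0 →
      (∀ n : ℤ, k₃ - k₁ ≠ 2 * π * n) → (∀ n : ℤ, k₃ - k₂ ≠ 2 * π * n) →
        det3 (phononPoint ω₂ k₁) (phononPoint ω₂ k₂) (-(phononPoint ω₂ k₃)) = 0

/-- Statement of `stub_antiInvariant_of_chord` (verbatim), keyed by the registered stub name. -/
abbrev stub_antiInvariant_of_chord : Prop :=
    ∀ ω₂ : ℝ, 0 < ω₂ →
      (∀ k₁ k₂ k₃ : ℝ, resonanceFn ω₂ k₁ k₂ k₃ = 0 →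
        (∀ n : ℤ, k₃ - k₁ ≠ 2 * π * n) → (∀ n : ℤ, k₃ - k₂ ≠ 2 * π * n) →
          det3 (phononPoint ω₂ k₁) (phononPoint ω₂ k₂) (-(phononPoint ω₂ k₃)) = 0) →
      ∀ (U : Set (ℝ × ℝ)) (h : ℝ × ℝ → ℝ), IsResonanceChart ω₂ U h →
        ∃ C : ℝ, ∀ p ∈ U,
          ellipticLog ω₂ p.1 + ellipticLog ω₂ (h p) + ellipticLog ω₂ p.2 +
            ellipticLog ω₂ (p.1 + h p - p.2) = C

/-- Statement of `stub_abelBolSpan` (verbatim), keyed by the registered stub name. -/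
abbrev stub_abelBolSpan : Prop :=
    ∀ ω₂ : ℝ, 0 < ω₂ → ∀ (U : Set (ℝ × ℝ)) (h : ℝ × ℝ → ℝ), IsResonanceChart ω₂ U h →
      (∃ C : ℝ, ∀ p ∈ U,
          ellipticLog ω₂ p.1 + ellipticLog ω₂ (h p) + ellipticLog ω₂ p.2 +
            ellipticLog ω₂ (p.1 + h p - p.2) = C) →
      ∀ g₁ g₂ g₃ g₄ : ℝ → ℝ, ContDiff ℝ (⊤ : ℕ∞) g₁ → ContDiff ℝ (⊤ : ℕ∞) g₂ →
        ContDiff ℝ (⊤ : ℕ∞) g₃ → ContDiff ℝ (⊤ : ℕ∞) g₄ →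
        (∀ p ∈ U, g₁ p.1 + g₂ (h p) + g₃ p.2 + g₄ (p.1 + h p - p.2) = 0) →
        ∃ α β γ c₁ c₂ c₃ c₄ : ℝ, ∀ p ∈ U,
          g₁ p.1 = α * p.1 + β * dispersion ω₂ p.1 + γ * ellipticLog ω₂ p.1 + c₁ ∧
          g₂ (h p) = α * h p + β * dispersion ω₂ (h p) + γ * ellipticLog ω₂ (h p) + c₂ ∧
          g₃ p.2 = -(α * p.2) - β * dispersion ω₂ p.2 + γ * ellipticLog ω₂ p.2 + c₃ ∧
          g₄ (p.1 + h p - p.2) = -(α * (p.1 + h p - p.2)) - β * dispersion ω₂ (p.1 + h p - p.2) +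
            γ * ellipticLog ω₂ (p.1 + h p - p.2) + c₄

/-- Statement of `stub_gluing` (verbatim), keyed by the registered stub name. -/
abbrev stub_gluing : Prop :=
    ∀ ω₂ : ℝ, 0 < ω₂ →
      (∀ (U : Set (ℝ × ℝ)) (h : ℝ × ℝ → ℝ), IsResonanceChart ω₂ U h →
        ∀ g₁ g₂ g₃ g₄ : ℝ → ℝ, ContDiff ℝ (⊤ : ℕ∞) g₁ → ContDiff ℝ (⊤ : ℕ∞) g₂ →
        ContDiff ℝ (⊤ : ℕ∞) g₃ → ContDiff ℝ (⊤ : ℕ∞) g₄ →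
        (∀ p ∈ U, g₁ p.1 + g₂ (h p) + g₃ p.2 + g₄ (p.1 + h p - p.2) = 0) →
        ∃ α β γ c₁ c₂ c₃ c₄ : ℝ, ∀ p ∈ U,
          g₁ p.1 = α * p.1 + β * dispersion ω₂ p.1 + γ * ellipticLog ω₂ p.1 + c₁ ∧
          g₂ (h p) = α * h p + β * dispersion ω₂ (h p) + γ * ellipticLog ω₂ (h p) + c₂ ∧
          g₃ p.2 = -(α * p.2) - β * dispersion ω₂ p.2 + γ * ellipticLog ω₂ p.2 + c₃ ∧
          g₄ (p.1 + h p - p.2) = -(α * (p.1 + h p - p.2)) - β * dispersion ω₂ (p.1 + h p - p.2) +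
            γ * ellipticLog ω₂ (p.1 + h p - p.2) + c₄) →
      ∀ ψ : ℝ → ℝ, ContDiff ℝ (⊤ : ℕ∞) ψ → Function.Periodic ψ (2 * π) →
        (∀ k₁ k₂ k₃ : ℝ, resonanceFn ω₂ k₁ k₂ k₃ = 0 → 0 < velocityGap ω₂ k₁ k₂ k₃ →
          ψ k₁ + ψ k₂ = ψ k₃ + ψ (k₁ + k₂ - k₃)) →
        ∃ c d : ℝ, ∀ k : ℝ, ψ k = c + d * dispersion ω₂ k

/-- Statement of `stub_bootstrap` (verbatim), keyed by the registered stub name. -/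
abbrev stub_bootstrap : Prop :=
    ∀ ω₂ a b : ℝ, 0 < ω₂ → 0 < a → 0 ≤ b → ∀ f : ℝ → ℝ, Function.Periodic f (2 * π) →
      Measurable f → cellNormSq f < ∞ → boltzmannForm ω₂ a b f = 0 →
        ∃ ψ : ℝ → ℝ, ContDiff ℝ (⊤ : ℕ∞) ψ ∧ Function.Periodic ψ (2 * π) ∧
          (∀ k₁ k₂ k₃ : ℝ, resonanceFn ω₂ k₁ k₂ k₃ = 0 → 0 < velocityGap ω₂ k₁ k₂ k₃ →
          ψ k₁ + ψ k₂ = ψ k₃ + ψ (k₁ + k₂ - k₃)) ∧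
          f =ᵐ[volume] ψ

/-- Statement of `stub_weylReduction` (verbatim), keyed by the registered stub name. -/
abbrev stub_weylReduction : Prop :=
    ∀ ω₂ a b : ℝ, 0 < ω₂ → 0 < a → 0 ≤ b →
      (∀ f : ℝ → ℝ, Function.Periodic f (2 * π) → Measurable f → Function.Odd f →
        cellNormSq f < ∞ → boltzmannForm ω₂ a b f = 0 → cellNormSq f = 0) →
      HasOddSectorGap ω₂ a b

end Registered

/-! ### Consistency: each registered statement IS its stub's type (definitionally) -/

example : Registered.stub_resonanceIsChord := stub_resonanceIsChord
example : Registered.stub_antiInvariant_of_chord := stub_antiInvariant_of_chord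
example : Registered.stub_abelBolSpan := stub_abelBolSpan
example : Registered.stub_gluing := stub_gluing
example : Registered.stub_bootstrap := stub_bootstrap
example : Registered.stub_weylReduction := stub_weylReduction

/-! ## The kernel-checked composition -/

/-- **Composition `FGRGap_of`.** S1 → S2 → S3 → S4 → S5 → S6 → `FGRGap` (sorry-free; concludes the
route decl BY NAME; hypotheses are the registered stubs BY NAME). Logic: fix `ω₂, a, b > 0`; by S6 it
suffices that odd periodic `L²` null vectors of `q` are null; S5 replaces such an `f` a.e. by a smooth
periodic `ψ` invariant at general-position resonances; S4, fed the chartwise span property assembled from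
S3 ∘ S2 ∘ S1, gives `ψ = c + dω` (even); `f` odd, `f =ᵐ ψ`, `ψ` continuous and Lebesgue measure
negation-invariant ⇒ `ψ` odd ⇒ `ψ ≡ 0` ⇒ `‖f‖² = 0`. -/
theorem FGRGap_of (h1 : Registered.stub_resonanceIsChord) (h2 : Registered.stub_antiInvariant_of_chord)
    (h3 : Registered.stub_abelBolSpan) (h4 : Registered.stub_gluing) (h5 : Registered.stub_bootstrap)
    (h6 : Registered.stub_weylReduction) :
    Summit.AtomisticToContinuum.FouriersLaw.Theses.EmbeddedDrudeMourre.FGRGap := by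
  intro ω₂ a b hω ha hb
  refine h6 ω₂ a b hω ha hb.le ?_
  intro f hper hmeas hodd hfin hq
  obtain ⟨ψ, hψs, hψp, hψinv, hfψ⟩ := h5 ω₂ a b hω ha hb.le f hper hmeas hfin hq
  -- the chartwise span property, assembled from S3 ∘ S2 ∘ S1, fed to the gluing S4
  obtain ⟨c, d, hcd⟩ := h4 ω₂ hω
    (fun U h hc => h3 ω₂ hω U h hc (h2 ω₂ hω (h1 ω₂ hω) U h hc)) ψ hψs hψp hψinv
  -- ψ = c + dω is even and continuous
  have hψc : Continuous ψ := hψs.continuous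
  have hψeven : ∀ k, ψ (-k) = ψ k := fun k => by rw [hcd (-k), hcd k, dispersion_neg]
  -- ψ is odd: f odd, f =ᵐ ψ, negation preserves Lebesgue measure, ψ continuous
  have hneg : (fun k => f (-k)) =ᵐ[volume] (fun k => ψ (-k)) :=
    (Measure.measurePreserving_neg (volume : Measure ℝ)).quasiMeasurePreserving.ae_eq_comp hfψ
  have hA : (fun k => ψ (-k)) =ᵐ[volume] (fun k => -ψ k) := by
    have h1' : (fun k => f (-k)) = fun k => -f k := funext fun k => hodd k
    have h2' : (fun k => -f k) =ᵐ[volume] (fun k => -ψ k) := by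
      filter_upwards [hfψ] with k hk
      simp [hk]
    rw [h1'] at hneg
    exact hneg.symm.trans h2'
  have hψodd : ∀ k, ψ (-k) = -ψ k := fun k =>
    congr_fun ((Continuous.ae_eq_iff_eq volume (hψc.comp continuous_neg) hψc.neg).1 hA) k
  have hψ0 : ∀ k, ψ k = 0 := fun k => by linarith [hψeven k, hψodd k]
  -- hence f = 0 a.e. and ‖f‖² = 0
  have hf0 : ∀ᵐ k ∂volume, f k = 0 := by
    filter_upwards [hfψ] with k hk
    rw [hk, hψ0 k]
  unfold cellNormSq
  have hint : (fun k => ENNReal.ofReal (f k ^ 2)) =ᵐ[volume.restrict (Ioc (-π) π)] fun _ => 0 := by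
    filter_upwards [ae_restrict_of_ae (s := Ioc (-π) π) hf0] with k hk
    simp [hk]
  rw [lintegral_congr_ae hint, lintegral_zero]

/-- Certificate that the six registered stubs (with their explicit signatures) feed the composition:
the crux modulo exactly the stubs (an `example`, not a theorem: it depends on the stubs' `sorry`s). -/
example : Summit.AtomisticToContinuum.FouriersLaw.Theses.EmbeddedDrudeMourre.FGRGap :=
  FGRGap_of stub_resonanceIsChord stub_antiInvariant_of_chord stub_abelBolSpan stub_gluing
    stub_bootstrap stub_weylReduction

/-! ## Checks against the landed Negative lemmas (Disproof honoured) -/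

/-- The hypotheses `0 < a`, `f` periodic, `f` odd carried by S5/S6 are exactly the load-bearing ones:
without periodicity `k ↦ k` (the abelian relation `R_k` of S3!) is a null vector — -/
example (ω₂ a b : ℝ) : boltzmannForm ω₂ a b (fun k => k) = 0 :=
  Summit.AtomisticToContinuum.FouriersLaw.Theorems.FGRGap.Negative.LoadBearing.boltzmannForm_id ω₂ a b

/-- — without oddness the even invariants `1, ω` (the relation `R_ω`, and the constants of S3) are null
vectors, which is why S4 classifies ALL smooth invariants as `c + dω` and `FGRGap_of` kills them by
oddness only at the end — -/
example (ω₂ a b c d : ℝ) : boltzmannForm ω₂ a b (fun k => c + d * dispersion ω₂ k) = 0 :=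
  boltzmannForm_const_add_mul_dispersion ω₂ a b c d

/-- — and the couplings enter S6 through `0 < a` alone (`0 ≤ b`): consistent with `onsite_of_crux`
(the `b = 0` gap is necessary) and with the harmonic kill `crux_false_without_couplings`. -/
example : ¬ ∀ ω₂ a b : ℝ, 0 < ω₂ → HasOddSectorGap ω₂ a b :=
  Summit.AtomisticToContinuum.FouriersLaw.Theorems.FGRGap.Negative.LoadBearing.crux_false_without_couplings

/-- The crux implies the hypothesis-free conclusion of S6 at every `0 < b` (so S6 is not stronger than
needed there) and, by the landed `onsite_of_crux`, the `b = 0` instance that S5/S6 also cover. -/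
example (h : Summit.AtomisticToContinuum.FouriersLaw.Theses.EmbeddedDrudeMourre.FGRGap) {ω₂ : ℝ}
    (hω : 0 < ω₂) : HasOddSectorGap ω₂ 1 0 :=
  Summit.AtomisticToContinuum.FouriersLaw.Theorems.FGRGap.Negative.OnsiteReduction.onsite_of_crux h hω

end Summit.AtomisticToContinuum.FouriersLaw.Cruxes.FGRGap.ChordQuarticAbel

end
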